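import Summits.BirchSwinnertonDyer.BirchSwinnertonDyer.Theorems.ByReductionTypeAtTwoSupersingularIwasawaAlgebraBiduality
import Literature.NumberTheory.EllipticCurves.Sprung2012.LocalIwasawaModule
import HarnessLib

/-!
# Route `ByReductionTypeAtTwo` (rung K4), crux `SupersingularRankZeroAtTwo` (item stmt-BirchSwinnertonDyer-19097), stub 5
# `stub_flatKernelCyclic` (hand h13), sub-hand h13b, brick (K1): **the local Kummer character of a point against a functional
# lies in the discrete dual `Λ^∨`** — for `x ∈ E(K_∞·K_v)` of level `n`, `k ≥ 0` and a functional `z : E(K_∞·K_v) →+ ℤ_p`,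
# the character `f ↦ (f • z)(x)/p^k` of `Λ` (the local Tate pairing of the Kummer class `x ⊗ p^{-k}` with the orbit `Λ • z`,
# action `Sprung2012.moduleOfGenerator`) kills `p^k Λ` and `T^{k·pⁿ} Λ` (cell `bsd-2adic`, seat `bsd-2adic-t42` GEN 44; `--supports 19097`,
# helper; sequel of `…IwasawaAlgebraBiduality`)

HONEST FRAMING (D-0036/D-0054): THEOREMS ONLY (no definition, no named fact, no `sorry`, no instance); generic `K`, `p`, `κ`, place `ι`,
`W`, local lift `g`.  This is the LOCAL, point-wise part of the Kummer injection `Sel_∞ ⧸ Sel♭ ↪ Λ^∨` (memo `t42/gen44/FLAT-KERNEL-CYCLIC-GEN44.md`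
§2); the global part (Selmer classes ↦ Kummer representatives, independence, equivariance, `⨅_σ` collapse) is NOT here.  19097 OPEN; BSD
proved for no curve.

* §1 `X_pow_prime_pow_eq_omega_add` — in `Λ`: `T^{pⁿ} = ω_n + p · h` (`ω_n = (1+T)^{pⁿ} − 1`; the tree's `IwasawaDual.exists_X_add_one_pow_prime_pow`);
  `omega_mul_smul_apply_eq_zero` — `((ω_n · q) • w)(x) = 0` for `x` of level `n` (`Sprung2012.lambdaSMul_apply_eq_aeval` with representative `0`);
  **`pow_dvd_X_pow_smul_apply`** — `p^k ∣ (T^{k·pⁿ} • w)(x)` for `x` of level `n`.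
* §2 **`comp_orbit_mem_dualLambda`** — for a pairing-character family `e` on `E(K_∞·K_v)` (`Literature.Algebra.Module`, ss-1 GEN 13) and
  the discrete dual `Q = Λ^∨` (membership criterion of `…IwasawaAlgebraBiduality`): `(e x k) ∘ (f ↦ f • z) ∈ Q`.

References: [Sprung2012] §2 p. 1486, Def. 3.1, Def. 7.9 (the local Tate pairing); [Washington1997] §7.1, §13.2; [Lang1990] Ch. 5 §1;
tree `Sprung2012/LocalIwasawaModule`, `IwasawaDualModule`, `PadicPairingFamilies`, p824877.
-/

set_option autoImplicit false
-- the Theorems namespace of this sub repeats the summit name by design (D-0017 nested layout)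
set_option linter.dupNamespace false

noncomputable section

open scoped Classical
open Polynomial

universe u

namespace Summit.BirchSwinnertonDyer.BirchSwinnertonDyer.Theorems

namespace OddBlindNF

namespace LambdaDual

open Literature.NumberTheory.EllipticCurves Literature.NumberTheory.EllipticCurves.IwasawaDual Literature.Algebra.Module
  Literature.NumberTheory.EllipticCurves.Sprung2012 Literature.NumberTheory.EllipticCurves.Sprung2017
  Literature.NumberTheory.EllipticCurves.Kobayashi2003 Literature.NumberTheory.GaloisRepresentations ZpExtension

variable {K : Type u} [Field K] {p : ℕ} [hp : Fact p.Prime] {κ : ZpExtension K p}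
variable {E : Type u} [Field E] [Algebra K E] {ι : AlgebraicClosure K →ₐ[K] AlgebraicClosure E}
variable {W : WeierstrassCurve K} {g : Field.absoluteGaloisGroup E}

/-! ### §1 `T^{pⁿ} = ω_n + p·h` and the vanishing of `ω_n` on level-`n` points -/

omit hp in
/-- **`T^{pⁿ} = ω_n + p · h` in `Λ = ℤ_p⟦T⟧`** (`ω_n = (1+T)^{pⁿ} − 1`; from `(X+1)^{pⁿ} − X^{pⁿ} − 1 ∈ p ℤ[X]`). [cite: Washington1997, §7.1 (ω_n)] -/
theorem X_pow_prime_pow_eq_omega_add [Fact p.Prime] (n : ℕ) :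
    ∃ h : PowerSeries ℤ_[p], (PowerSeries.X : PowerSeries ℤ_[p]) ^ p ^ n =
      toIwasawa p (cyclotomicOmega p n) + (p : PowerSeries ℤ_[p]) * h := by
  obtain ⟨R, hR⟩ := IwasawaDual.exists_X_add_one_pow_prime_pow (Fact.out : p.Prime) n
  refine ⟨-(Polynomial.eval₂ (Int.castRingHom (PowerSeries ℤ_[p])) PowerSeries.X R), ?_⟩
  have h := congrArg (Polynomial.eval₂ (Int.castRingHom (PowerSeries ℤ_[p])) (PowerSeries.X : PowerSeries ℤ_[p])) hR
  simp only [Polynomial.eval₂_sub, Polynomial.eval₂_mul, Polynomial.eval₂_pow, Polynomial.eval₂_add, Polynomial.eval₂_X,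
    Polynomial.eval₂_one, map_natCast, Polynomial.eval₂_natCast] at h
  rw [toIwasawa_cyclotomicOmega_eq_coe, Polynomial.coe_sub, Polynomial.coe_pow, Polynomial.coe_add, Polynomial.coe_X,
    Polynomial.coe_one]
  linear_combination -h

/-- **`ω_n` kills the values on level-`n` points**: `((ω_n · q) • w)(x) = 0` for every functional `w`, every `q ∈ Λ` and every
`x ∈ E(K_n·K_v)` (the defining formula of the action with representative `0`). [cite: Sprung2012, §2 p. 1486 and Def. 3.1 (p. 1489)] -/
theorem omega_mul_smul_apply_eq_zero (hg : κ.IsTopGenerator (resGalOfEmb ι g)) (n : ℕ) (q : PowerSeries ℤ_[p])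
    (w : localTowerPointsOfEmb κ ι W →+ ℤ_[p]) {x : localPoints W E} (hx : x ∈ localLayerPointsOfEmb κ ι W n) :
    (letI := moduleOfGenerator κ ι W hg
     ((toIwasawa p (cyclotomicOmega p n) * q) • w) ⟨x, localLayerPointsOfEmb_le_localTowerPointsOfEmb κ ι W n hx⟩) = 0 := by
  rw [moduleOfGenerator_smul_eq, lambdaSMul_apply_eq_aeval hg _ w (n := n) (r := 0)
    (by rw [Polynomial.coe_zero, sub_zero]; exact dvd_mul_right _ _) hx, map_zero, LinearMap.zero_apply,
    AddMonoidHom.zero_apply]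

/-- **`p^k ∣ (T^{k·pⁿ} • w)(x)` for `x` of level `n`**: `T^{k pⁿ} = (ω_n + p h)^k ∈ ω_n Λ + p^k Λ`, `ω_n` kills level-`n` values and the
constants act through `ℤ_p`. [cite: Sprung2012, Def. 3.1 (p. 1489)] [cite: Lang1990, Ch. 5 §1] -/
theorem pow_dvd_X_pow_smul_apply (hg : κ.IsTopGenerator (resGalOfEmb ι g)) (n k : ℕ)
    (w : localTowerPointsOfEmb κ ι W →+ ℤ_[p]) {x : localPoints W E} (hx : x ∈ localLayerPointsOfEmb κ ι W n) :
    (p : ℤ_[p]) ^ k ∣ (letI := moduleOfGenerator κ ι W hg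
      ((PowerSeries.X : PowerSeries ℤ_[p]) ^ (k * p ^ n) • w) ⟨x, localLayerPointsOfEmb_le_localTowerPointsOfEmb κ ι W n hx⟩) := by
  letI := moduleOfGenerator κ ι W hg
  obtain ⟨h, hh⟩ := X_pow_prime_pow_eq_omega_add (p := p) n
  -- `T^{k pⁿ} = (ω + p h)^k = ω q + (p h)^k`
  obtain ⟨q, hq⟩ := sub_dvd_pow_sub_pow (toIwasawa p (cyclotomicOmega p n) + (p : PowerSeries ℤ_[p]) * h)
    ((p : PowerSeries ℤ_[p]) * h) k
  rw [add_sub_cancel_right] at hq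
  have hX : (PowerSeries.X : PowerSeries ℤ_[p]) ^ (k * p ^ n) =
      toIwasawa p (cyclotomicOmega p n) * q + PowerSeries.C ((p : ℤ_[p]) ^ k) * h ^ k := by
    rw [mul_comm k, pow_mul, hh, map_pow, map_natCast, ← mul_pow]
    linear_combination hq
  refine ⟨(h ^ k • w) ⟨x, localLayerPointsOfEmb_le_localTowerPointsOfEmb κ ι W n hx⟩, ?_⟩
  rw [hX, add_smul, AddMonoidHom.add_apply, omega_mul_smul_apply_eq_zero hg n q w hx, zero_add, mul_smul,
    moduleOfGenerator_smul_eq hg (PowerSeries.C _), lambdaSMul_C, AddMonoidHom.smul_apply, smul_eq_mul]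

/-! ### §2 The local Kummer character `f ↦ (f • z)(x)/p^k` lies in `Λ^∨` -/

/-- **The local Kummer character of `(x, k)` against the orbit `Λ • z` lies in the discrete dual `Λ^∨`.**  For a pairing-character
family `e` on `N = E(K_∞·K_v)` (`e x k z' = z'(x)/p^k mod ℤ`), a functional `z`, a point `x` (of some level `n`) and `k ≥ 0`: the character
`f ↦ e x k (f • z)` of `(Λ, +)` kills `p^k Λ` (constants act through `ℤ_p`, `p^k · (x ⊗ p^{-k}) = 0`) and `T^{k·pⁿ} Λ` (§1), so it
satisfies the membership criterion of `Λ^∨`.  With `z = z♭` (`Ker Col♭ = Λ ∙ z♭`) this is the value of the Kummer injection on the class of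
`x ⊗ p^{-k}`. [cite: Sprung2012, Def. 7.9 (p. 1503) (the local Tate pairing)] [cite: NeukirchSchmidtWingberg2008, I §1 (1.1.8)] -/
theorem comp_orbit_mem_dualLambda (hg : κ.IsTopGenerator (resGalOfEmb ι g))
    {e : localTowerPointsOfEmb κ ι W → ℕ → ((localTowerPointsOfEmb κ ι W →+ ℤ_[p]) →+ AddCircle (1 : ℚ))}
    (he : ∀ (x : localTowerPointsOfEmb κ ι W) (k : ℕ) (z : localTowerPointsOfEmb κ ι W →+ ℤ_[p]) (a : ℤ),
      PadicInt.toZModPow k (z x) = (a : ZMod (p ^ k)) → e x k z = (((a : ℚ) / (p : ℚ) ^ k : ℚ) : AddCircle (1 : ℚ)))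
    {Q : AddSubgroup (PowerSeries ℤ_[p] →+ AddCircle (1 : ℚ))}
    (hQ : ∀ χ, χ ∈ Q ↔ ∃ n k : ℕ, (∀ f, χ (PowerSeries.X ^ n * f) = 0) ∧ (∀ f, χ ((p : PowerSeries ℤ_[p]) ^ k * f) = 0))
    (x : localTowerPointsOfEmb κ ι W) (k : ℕ) (z : localTowerPointsOfEmb κ ι W →+ ℤ_[p]) :
    letI := moduleOfGenerator κ ι W hg
    (e x k).comp ((smulAddHom (PowerSeries ℤ_[p]) (localTowerPointsOfEmb κ ι W →+ ℤ_[p])).flip z) ∈ Q := by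
  letI := moduleOfGenerator κ ι W hg
  obtain ⟨n, hn⟩ := exists_mem_localLayerPointsOfEmb_of_mem_localTowerPointsOfEmb κ ι W x.2
  have hx : x = ⟨(x : localPoints W E), localLayerPointsOfEmb_le_localTowerPointsOfEmb κ ι W n hn⟩ := rfl
  refine (hQ _).mpr ⟨k * p ^ n, k, fun f ↦ ?_, fun f ↦ ?_⟩
  · -- kills `T^{k pⁿ}`
    rw [AddMonoidHom.comp_apply, AddMonoidHom.flip_apply, smulAddHom_apply, padicPairingFamily_apply_eq_zero_iff he, mul_smul, hx]
    exact pow_dvd_X_pow_smul_apply hg n k (f • z) hn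
  · -- kills `p^k`
    rw [AddMonoidHom.comp_apply, AddMonoidHom.flip_apply, smulAddHom_apply, mul_smul,
      show ((p : PowerSeries ℤ_[p]) ^ k) = PowerSeries.C ((p : ℤ_[p]) ^ k) by rw [map_pow, map_natCast],
      moduleOfGenerator_smul_eq hg (PowerSeries.C _), lambdaSMul_C, ← Nat.cast_pow, Nat.cast_smul_eq_nsmul, map_nsmul,
      ← AddMonoidHom.nsmul_apply, padicPairingFamily_pow_nsmul he, AddMonoidHom.zero_apply]

end LambdaDual

end OddBlindNF

end Summit.BirchSwinnertonDyer.BirchSwinnertonDyer.Theorems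

end
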